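import Mathlib
import Literature.Analysis.FluidPDE.SuitableWeak
import Literature.Analysis.FluidPDE.WeakSolution
import Literature.Analysis.FluidPDE.WholeSpaceIBP
import Literature.Analysis.FluidPDE.WeakGradientIBP
import HarnessLib

/-!
# Tools for the FINITE-BACKWARD-FLUX stratum of the crux `EulerZoomLiouville.PowerGaugeEulerLiouville`

Route `EulerZoomLiouville` (NavierStokesRegularity), crux E = stmt-NavierStokesRegularity-19832
`PowerGaugeEulerLiouville` (Seregin's power-gauged ancient Euler class is trivial; OPEN on `0 < ρ ≤ 1/2`).
Companion of `EulerZoomLiouvillePowerGaugeEulerLiouvilleFlux.lean` («a nontrivial member must import an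
infinite amount of cubic flux from spatial infinity over its past»); route-independent tools about the
tree's cut-offs `cutoff R` (`WholeSpaceIBP.lean`) and the Euler energy flux `(|u|² + 2p) u·∇φ_R`:

* `cutoffFacts` — `φ_R = cutoff R`: smooth, compactly supported, `0 ≤ φ_R ≤ 1`, `= 1` and `∇φ_R = 0`
  on `B(0,R)`, `φ_R ≠ 0 ⇒ ‖x‖ < 2R + 1`, and `|⟪v, ∇φ_R(x)⟫| ≤ (C/R) ‖v‖ 1_{R ≤ ‖x‖ ≤ 2R}`;
* `abs_eulerFlux_cutoff_le` — the pointwise bound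
  `|(‖u‖² + 2p) ⟪u, ∇φ_R⟫| ≤ 2C · (‖u‖³ + 2|p|‖u‖) / max 1 ‖x‖ · 1_{R ≤ ‖x‖}` (`R ≥ 1`);
* `tendsto_setIntegral_fluxDensity` — for `g` integrable on `(−∞, b) × ℝ³`,
  `∫_{(−∞,b) × {‖x‖ ≥ k+1}} g → 0` as `k → ∞`.

WHAT THIS IS NOT: not NS — bookkeeping for the stratum. [folklore]
-/

noncomputable section

set_option linter.dupNamespace false

open MeasureTheory Set Filter Topology Metric Function TopologicalSpace
open scoped ENNReal NNReal InnerProductSpace RealInnerProductSpace Laplacian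

namespace Summit.NavierStokesRegularity.NavierStokesRegularity.Theorems.PowerGaugeEulerLiouville

open Literature.Analysis Literature.Analysis.FunctionSpaces Literature.Analysis.FluidPDE

/-! ## The cut-offs `φ_R` -/

/-- **Facts about the tree's cut-off `cutoff R` on `ℝ³`** (`R > 0`), with the gradient constant `C` of
`exists_norm_fderiv_cutoff_le`. [folklore] -/
theorem cutoffFacts :
    ∃ C : ℝ, 0 ≤ C ∧ ∀ R : ℝ, 0 < R →
      ContDiff ℝ (⊤ : ℕ∞) (cutoff (E := EuclideanSpace ℝ (Fin 3)) R) ∧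
      HasCompactSupport (cutoff (E := EuclideanSpace ℝ (Fin 3)) R) ∧
      (∀ x : EuclideanSpace ℝ (Fin 3), 0 ≤ cutoff R x) ∧ (∀ x : EuclideanSpace ℝ (Fin 3), cutoff R x ≤ 1) ∧
      (∀ x ∈ ball (0 : EuclideanSpace ℝ (Fin 3)) R, cutoff R x = 1) ∧
      (∀ x ∈ ball (0 : EuclideanSpace ℝ (Fin 3)) R, gradient (cutoff R) x = 0) ∧
      (∀ x : EuclideanSpace ℝ (Fin 3), cutoff R x ≠ 0 → x ∈ ball (0 : EuclideanSpace ℝ (Fin 3)) (2 * R + 1)) ∧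
      (∀ x v : EuclideanSpace ℝ (Fin 3), |⟪v, gradient (cutoff R) x⟫| ≤ C / R * ‖v‖) ∧
      (∀ x : EuclideanSpace ℝ (Fin 3), 2 * R < ‖x‖ → gradient (cutoff R) x = 0) := by
  obtain ⟨C, hC0, hC⟩ := exists_norm_fderiv_cutoff_le (E := EuclideanSpace ℝ (Fin 3))
  refine ⟨C, hC0, fun R hR => ⟨contDiff_cutoff R, hasCompactSupport_cutoff hR, fun x => cutoff_nonneg R x,
    fun x => cutoff_le_one R x, fun x hx => cutoff_eq_one hR (le_of_lt (mem_ball_zero_iff.1 hx)),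
    fun x hx => ?_, fun x hx => ?_, fun x v => ?_, fun x hx => ?_⟩⟩
  · -- locally constant `= 1` on the open ball
    have h1 : cutoff (E := EuclideanSpace ℝ (Fin 3)) R =ᶠ[𝓝 x] fun _ => (1 : ℝ) := by
      filter_upwards [isOpen_ball.mem_nhds hx] with y hy
      exact cutoff_eq_one hR (le_of_lt (mem_ball_zero_iff.1 hy))
    rw [gradient, h1.fderiv_eq]
    simp
  · by_contra hfar
    rw [mem_ball_zero_iff, not_lt] at hfar
    exact hx (cutoff_eq_zero hR (by linarith))
  · rw [inner_gradient_eq_fderiv_apply]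
    calc |fderiv ℝ (cutoff R) x v| = ‖fderiv ℝ (cutoff R) x v‖ := (Real.norm_eq_abs _).symm
      _ ≤ ‖fderiv ℝ (cutoff R) x‖ * ‖v‖ := ContinuousLinearMap.le_opNorm _ _
      _ ≤ C / R * ‖v‖ := by gcongr; exact hC R hR x
  · -- locally constant `= 0` beyond `2R`
    have h1 : cutoff (E := EuclideanSpace ℝ (Fin 3)) R =ᶠ[𝓝 x] fun _ => (0 : ℝ) := by
      have hopen : IsOpen {y : EuclideanSpace ℝ (Fin 3) | 2 * R < ‖y‖} := isOpen_lt continuous_const continuous_norm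
      filter_upwards [hopen.mem_nhds hx] with y hy
      exact cutoff_eq_zero hR (le_of_lt hy)
    rw [gradient, h1.fderiv_eq]
    simp

/-! ## The pointwise flux bound -/

/-- **Pointwise bound for the Euler energy flux through the cut-off `φ_R`** (`R ≥ 1`):
`|(‖u‖² + 2p)⟪u, ∇φ_R⟫| ≤ 2C · ((‖u‖³ + 2|p|‖u‖) / max 1 ‖x‖) · 1_{R ≤ ‖x‖}`,
since `|∇φ_R| ≤ C/R` lives on `R ≤ ‖x‖ ≤ 2R`, where `1/R ≤ 2/max(1,‖x‖)`. [folklore] -/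
theorem abs_eulerFlux_cutoff_le {C R : ℝ} (hC : 0 ≤ C) (hR : 1 ≤ R)
    (hgrad : ∀ x v : EuclideanSpace ℝ (Fin 3), |⟪v, gradient (cutoff R) x⟫| ≤ C / R * ‖v‖)
    (hin : ∀ x ∈ ball (0 : EuclideanSpace ℝ (Fin 3)) R, gradient (cutoff R) x = 0)
    (hout : ∀ x : EuclideanSpace ℝ (Fin 3), 2 * R < ‖x‖ → gradient (cutoff R) x = 0)
    (v : EuclideanSpace ℝ (Fin 3)) (q : ℝ) (x : EuclideanSpace ℝ (Fin 3)) :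
    |(‖v‖ ^ 2 + 2 * q) * ⟪v, gradient (cutoff R) x⟫| ≤
      2 * C * ((‖v‖ ^ 3 + 2 * |q| * ‖v‖) / max 1 ‖x‖) *
        ({y : EuclideanSpace ℝ (Fin 3) | R ≤ ‖y‖}.indicator (fun _ => (1 : ℝ)) x) := by
  by_cases hxR : R ≤ ‖x‖
  · rw [indicator_of_mem (show x ∈ {y : EuclideanSpace ℝ (Fin 3) | R ≤ ‖y‖} from hxR), mul_one]
    by_cases hx2 : 2 * R < ‖x‖
    · rw [hout x hx2, inner_zero_right, mul_zero, abs_zero]; positivity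
    · rw [not_lt] at hx2
      have hmax : max 1 ‖x‖ ≤ 2 * R := max_le (by linarith) hx2
      have hmaxpos : 0 < max 1 ‖x‖ := lt_of_lt_of_le one_pos (le_max_left _ _)
      have hRpos : 0 < R := by linarith
      have h1 : |(‖v‖ ^ 2 + 2 * q) * ⟪v, gradient (cutoff R) x⟫| ≤ (‖v‖ ^ 2 + 2 * |q|) * (C / R * ‖v‖) := by
        rw [abs_mul]
        refine mul_le_mul ?_ (hgrad x v) (abs_nonneg _) (by positivity)
        calc |‖v‖ ^ 2 + 2 * q| ≤ |‖v‖ ^ 2| + |2 * q| := abs_add_le _ _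
          _ = ‖v‖ ^ 2 + 2 * |q| := by rw [abs_of_nonneg (sq_nonneg _), abs_mul, abs_two]
      refine h1.trans ?_
      have h2 : C / R ≤ 2 * C / max 1 ‖x‖ := by
        rw [div_le_div_iff₀ hRpos hmaxpos]
        nlinarith
      calc (‖v‖ ^ 2 + 2 * |q|) * (C / R * ‖v‖) = C / R * (‖v‖ ^ 3 + 2 * |q| * ‖v‖) := by ring
        _ ≤ 2 * C / max 1 ‖x‖ * (‖v‖ ^ 3 + 2 * |q| * ‖v‖) := by gcongr
        _ = 2 * C * ((‖v‖ ^ 3 + 2 * |q| * ‖v‖) / max 1 ‖x‖) := by ring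
  · rw [not_le] at hxR
    rw [hin x (mem_ball_zero_iff.2 hxR), inner_zero_right, mul_zero, abs_zero,
      indicator_of_notMem (show x ∉ {y : EuclideanSpace ℝ (Fin 3) | R ≤ ‖y‖} from fun h => absurd h (not_le.2 hxR)),
      mul_zero]

/-! ## The backward flux density over far regions tends to zero -/

/-- If `g` is integrable on `(−∞, b) × ℝ³`, then `∫_{(−∞,b) × {‖x‖ ≥ k+1}} g → 0` as `k → ∞`
(dominated convergence over the decreasing far regions, whose intersection is empty). [folklore] -/
theorem tendsto_setIntegral_far {g : ℝ × EuclideanSpace ℝ (Fin 3) → ℝ} {b : ℝ}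
    (hg : IntegrableOn g (Iio b ×ˢ (univ : Set (EuclideanSpace ℝ (Fin 3)))) volume) :
    Tendsto (fun k : ℕ => ∫ z in Iio b ×ˢ {x : EuclideanSpace ℝ (Fin 3) | (k : ℝ) + 1 ≤ ‖x‖}, g z)
      atTop (𝓝 0) := by
  set s : ℕ → Set (ℝ × EuclideanSpace ℝ (Fin 3)) :=
    fun k => Iio b ×ˢ {x : EuclideanSpace ℝ (Fin 3) | (k : ℝ) + 1 ≤ ‖x‖} with hs
  have hsm : ∀ k, MeasurableSet (s k) := fun k =>
    measurableSet_Iio.prod (measurableSet_le measurable_const measurable_norm)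
  have hanti : Antitone s := by
    intro j k hjk z hz
    refine ⟨hz.1, ?_⟩
    have h1 : (k : ℝ) + 1 ≤ ‖z.2‖ := hz.2
    have h2 : (j : ℝ) ≤ k := by exact_mod_cast hjk
    show (j : ℝ) + 1 ≤ ‖z.2‖
    linarith
  have hfi : IntegrableOn g (s 0) volume := hg.mono_set (prod_mono Subset.rfl (subset_univ _))
  have h := Antitone.tendsto_setIntegral hsm hanti hfi
  have hempty : (⋂ k, s k) = ∅ := by
    refine eq_empty_of_forall_notMem fun z hz => ?_
    rw [mem_iInter] at hz
    obtain ⟨k, hk⟩ := exists_nat_gt ‖z.2‖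
    have := (hz k).2
    simp only [mem_setOf_eq] at this
    linarith
  rw [hempty, Measure.restrict_empty, integral_zero_measure] at h
  exact h

end Summit.NavierStokesRegularity.NavierStokesRegularity.Theorems.PowerGaugeEulerLiouville

end
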